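import Mathlib
import Literature.Geometry.DiscreteGeometry.KissingPatterns

/-!
# Cleanness at scale `a` is translation invariant

Helper for the crux `GappedShellCensus.CleanLimitsHaveWindows` (stmt-AtomisticToContinuum-15932), line
`Sketch`, stub `stub_cleanTranslate`. "Everywhere clean at scale `a`" for a set `Y ⊆ ℝ³` means: every site
`y ∈ Y` is gapped-twelve (exactly `12` other points within `a(1 + 1/50)`, none closer than `a(1 - 1/50)`,
none in the open annulus `(a(1 + 1/50), 63a/50)`) and its bond shell, recentred at `y` and rescaled by
`a⁻¹`, is `1/5`-close to the fcc or the hcp kissing pattern. This is pure bookkeeping: translating `Y` by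
`-v` preserves all distances, the shell of `y - v` in `Y - v` is the translate of the shell of `y` in `Y`,
and the recentred rescaled shell is literally the same finite set.
-/

noncomputable section

namespace Summit.AtomisticToContinuum.Crystallization.Theorems.CleanHull

open Literature.Geometry.DiscreteGeometry

/-- The bond shell (radius `r`) of `y - v` in the translate `Y - v` is the translate by `-v` of the bond
shell of `y` in `Y`. [folklore] -/
theorem shell_translate_eq (Y : Set (EuclideanSpace ℝ (Fin 3))) (v y : EuclideanSpace ℝ (Fin 3))
    (r : ℝ) :
    {w ∈ (fun p => p - v) '' Y | w ≠ y - v ∧ dist (y - v) w ≤ r} =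
      (fun p => p - v) '' {w ∈ Y | w ≠ y ∧ dist y w ≤ r} := by
  ext w
  simp only [Set.mem_setOf_eq, Set.mem_image]
  constructor
  · rintro ⟨⟨p, hp, rfl⟩, hne, hd⟩
    refine ⟨p, ⟨hp, ?_, ?_⟩, rfl⟩
    · rintro rfl
      exact hne rfl
    · rwa [dist_sub_right] at hd
  · rintro ⟨p, ⟨hp, hne, hd⟩, rfl⟩
    refine ⟨⟨p, hp, rfl⟩, ?_, ?_⟩
    · intro h
      exact hne (sub_left_injective h)
    · rwa [dist_sub_right]

/-- The recentred shell is translation invariant: recentring the translated shell at `y - v` gives the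
same set as recentring the original shell at `y`. [folklore] -/
theorem recentred_shell_translate_eq (a : ℝ) (S : Set (EuclideanSpace ℝ (Fin 3)))
    (v y : EuclideanSpace ℝ (Fin 3)) :
    (fun w => a⁻¹ • (w - (y - v))) '' ((fun p => p - v) '' S) = (fun w => a⁻¹ • (w - y)) '' S := by
  rw [Set.image_image]
  refine Set.image_congr' fun w => ?_
  simp only [sub_sub_sub_cancel_right]

/-- **Stub S0 (cleanness is translation invariant).** If every site of `Y` is gapped-twelve at scale `a`
with rescaled recentred bond shell `1/5`-close to the fcc or hcp kissing pattern, then the same holds for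
every site of the translate `Y - v`. [folklore] -/
theorem stub_cleanTranslate (a : ℝ) (Y : Set (EuclideanSpace ℝ (Fin 3))) (v : EuclideanSpace ℝ (Fin 3))
    (hY : ∀ y ∈ Y, ({w ∈ Y | w ≠ y ∧ dist y w ≤ a * (1 + 1 / 50)}.ncard = 12 ∧
        ∀ w ∈ Y, w ≠ y → a * (1 - 1 / 50) ≤ dist y w ∧
          (dist y w ≤ a * (1 + 1 / 50) ∨ a * (63 / 50) ≤ dist y w)) ∧
      ∃ T : Finset (EuclideanSpace ℝ (Fin 3)), (↑T : Set (EuclideanSpace ℝ (Fin 3))) =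
          (fun w => a⁻¹ • (w - y)) '' {w ∈ Y | w ≠ y ∧ dist y w ≤ a * (1 + 1 / 50)} ∧
        (ShellCloseTo (1 / 5) T fccKissingPattern ∨ ShellCloseTo (1 / 5) T hcpKissingPattern)) :
    ∀ y ∈ (fun p => p - v) '' Y,
      ({w ∈ (fun p => p - v) '' Y | w ≠ y ∧ dist y w ≤ a * (1 + 1 / 50)}.ncard = 12 ∧
        ∀ w ∈ (fun p => p - v) '' Y, w ≠ y → a * (1 - 1 / 50) ≤ dist y w ∧
          (dist y w ≤ a * (1 + 1 / 50) ∨ a * (63 / 50) ≤ dist y w)) ∧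
      ∃ T : Finset (EuclideanSpace ℝ (Fin 3)), (↑T : Set (EuclideanSpace ℝ (Fin 3))) =
          (fun w => a⁻¹ • (w - y)) '' {w ∈ (fun p => p - v) '' Y | w ≠ y ∧ dist y w ≤ a * (1 + 1 / 50)} ∧
        (ShellCloseTo (1 / 5) T fccKissingPattern ∨ ShellCloseTo (1 / 5) T hcpKissingPattern) := by
  rintro _ ⟨y, hy, rfl⟩
  obtain ⟨⟨hcount, hgap⟩, T, hT, hclose⟩ := hY y hy
  refine ⟨⟨?_, ?_⟩, T, ?_, hclose⟩
  · -- the count: the translated shell is the injective image of the shell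
    rw [shell_translate_eq, Set.ncard_image_of_injective _ sub_left_injective, hcount]
  · -- the gap: distances are translation invariant
    rintro _ ⟨w, hw, rfl⟩ hne
    have hne' : w ≠ y := fun h => hne (by rw [h])
    simpa only [dist_sub_right] using hgap w hw hne'
  · -- the shell finset: literally the same `T`
    rw [shell_translate_eq, recentred_shell_translate_eq, hT]

end Summit.AtomisticToContinuum.Crystallization.Theorems.CleanHull
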